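import Summits.BirchSwinnertonDyer.BirchSwinnertonDyer.Theorems.AlignedTransportAtTwoMainConjectureOfRankZeroBSDAtTwoHalfDescentHighGrowth
import HarnessLib

/-!
# Route `AlignedTransportAtTwo`, crux C2 `MainConjectureOfRankZeroBSDAtTwo` (stmt-BirchSwinnertonDyer-22298):
# KATO IN HALF-DEGREE COORDINATES, XI — THE HIGH-CHARACTER / LAYER-GROWTH DATUM AT ANY PRIME `p`: Kato's divisibility at `p` plus ONE exact value match at a
# character of order `p^{n+1}` with `λ_an < (p−1)p^n` (equivalently ONE growth equality `φ·μ_alg + λ_alg = φ·μ_an + λ_an`) gives `char_Λ X = (G)` at the datum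

HONEST FRAMING (cell `bsd-f1-sign2`, WIDTH-5 attached prover seat `bsd-line-att-p5` gen 53 on line `birth` of the lead `bsd-line-att-p2`;
`--supports` stmt-BirchSwinnertonDyer-22298, closes nothing; BSD is NOT proved by any of this; the crux C2, its verdict «blocked-on
`Rank1Residual.GreenbergMuConjectureIrreducible`» and every registered stub (P / T / Kμ / LimDoor / MuIneqʳ / PFμ⁺) are untouched). THEOREMS ONLY — no `def`,
no instance, no `sorry`; ONE PRINT binder (`h17` = Kato's Thm. 17.4 (1)(2) at `p`, the tree's `kato_divisibility_allPrimes W p`). Sequel of `…HalfDescentHighGrowth`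
(this gen, `p = 2` datum); here the SAME statements for an arbitrary prime `p` of good ordinary reduction — for the odd-`p` seats (kdd / t42): at odd `p` the first
layer already carries characters of order `p` with `φ(p) = p − 1`, so for `λ_an < p − 1` ONE character of ORDER `p` suffices, and for `λ_an < p(p−1)` one of order `p²`.
* ★★ `norm_lt_norm_iff_mu_lt` / ★★★ `norm_eq_norm_iff_mu_eq_and_lam_eq` (any `p`, pure `Λ`): for a Kato pair `F ∣ p^a·G` at a point `z` high for `G`
  (`|z|^{λ(G)} > 1/p`) the COMPARISON OF THE TWO VALUES IS THE COMPARISON OF `μ`: **`|F(z)| < |G(z)| ⟺ μ(G) < μ(F)`** and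
  **`|F(z)| = |G(z)| ⟺ μ(F) = μ(G) ∧ λ(F) = λ(G)`**, while `μ(F) = μ(G)` alone gives `|F(z)| ≥ |G(z)|`; so when `μ(G) ≤ μ(F)` is known (weight-, twin- or
  layer-certified pairs, gens 52–53) the algebraic value is STRICTLY BELOW the analytic one iff `μ_alg > μ_an` — for C2 on a weight-certified seed (where
  `μ`-equality forces `λ`-equality, gen 52): at a high character EITHER the two values match (MC at the datum) OR the algebraic one is strictly smaller
  (Greenberg's `μ_alg = 0` fails for the seed); it is never larger.
* `charGen_dvd_C_pow_mul_lift` (any `p`, PRINT `h17`): `f_X ∣ p^n·G` for an integral lift `G` of `L_p(f, α)` (the tree's `O1.MuZeroUpgrade.exists_mul_charGen_eq_of_kato_allPrimes` at `ϖ = 1`).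
* ★★★ `charIdeal_eq_of_kato_of_highCharacterCertified` (any `p`): ONE exact match `|f_X(ζ−1)| = |G(ζ−1)|` at ONE `ζ` of exact order `p^{n+1}` with `λ(G) < (p−1)p^n`
  ⟹ `μ(f_X) = μ(G)`, `λ(f_X) = λ(G)`, `char_Λ X = (G)`.
* ★★★ `charIdeal_eq_of_kato_of_growth_eq` (any `p`): ONE integer equality `(p−1)p^n·μ(f_X) + λ(f_X) = (p−1)p^n·μ(G) + λ(G)` with `λ(G) < (p−1)p^n` ⟹ the same.
Two-sided companion of gen 50's one-sided layer-value door (`…LayerValueDoor`, `p = 2`); no `μ = 0` input, no BSD_p(W) input. Memo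
`Cruxes/MainConjectureOfRankZeroBSDAtTwo/LAYER-LAW-att-p5-g53.md`. BSD is not proved by any of this; nothing about any curve's BSD_p is asserted here.

References: K. Kato, Astérisque 295 (2004) Thm. 17.4 [Kato2004Asterisque]; L. Washington, GTM 83, §7.1–7.2 (Thm. 7.3), §13.3 (Thm. 13.13) [Washington1997];
R. Greenberg, LNM 1716 (1999) p. 180 [GreenbergLNM1716]; R. Greenberg, V. Vatsal, Invent. Math. 142 (2000) p. 4 [GreenbergVatsal2000].
-/

set_option linter.dupNamespace false
set_option autoImplicit false

noncomputable section

open scoped Classical MatrixGroups ModularForm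

namespace Summit.BirchSwinnertonDyer.BirchSwinnertonDyer.Theorems.AlignedTransportAtTwoHalfDescentHighGrowthAnyPrime

open PowerSeries CongruenceSubgroup WeierstrassCurve Literature.NumberTheory.EllipticCurves
  Literature.NumberTheory.EllipticCurves.IwasawaAlgebra
  Literature.NumberTheory.EllipticCurves.ModularForms
  Literature.NumberTheory.EllipticCurves.Rank1Residual
  Summit.BirchSwinnertonDyer.Rank1Residual
  Summit.BirchSwinnertonDyer.Rank1Residual.X1.MuLambda
  Summit.BirchSwinnertonDyer.Rank1Residual.X5
  Summit.BirchSwinnertonDyer.Rank1Residual.Iwasawa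
  Summit.BirchSwinnertonDyer.BirchSwinnertonDyer.Theorems.AlignedTransportAtTwoHalfDescentKato
  Summit.BirchSwinnertonDyer.BirchSwinnertonDyer.Theorems.AlignedTransportAtTwoHalfDescentDefectLayersLaw
  Summit.BirchSwinnertonDyer.BirchSwinnertonDyer.Theorems.AlignedTransportAtTwoHalfDescentHighCharacter
  Summit.BirchSwinnertonDyer.BirchSwinnertonDyer.Theorems.AlignedTransportAtTwoHalfDescentHighGrowth

/-! ## §1 The comparison of values at a high point is the comparison of `μ` (any `p`, pure `Λ`) -/

section Compare

variable {p : ℕ} [hp : Fact p.Prime]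

/-- ★★ **`|F(z)| < |G(z)| ⟺ μ(G) < μ(F)` at a point high for `G`.** `F, G ∈ Λ ∖ {0}`, `F ∣ p^a·G`, `|z| < 1`, `|z|^{λ(G)} > 1/p`. Both values are read exactly
(`p^{−μ}|z|^{λ}`, `λ(F) ≤ λ(G)`), and a unit of `μ` outweighs the whole range of `|z|^λ`. [cite: Washington1997, §7.1–7.2 and Thm. 7.3]
[cite: GreenbergVatsal2000, p. 4, (1)–(2)] -/
theorem norm_lt_norm_iff_mu_lt {F G : IwasawaAlgebra p} (hF : F ≠ 0) (hG : G ≠ 0) {a : ℕ}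
    (hdvd : F ∣ PowerSeries.C ((p : ℤ_[p]) ^ a) * G) {z : ℂ_[p]} (hz : ‖z‖ < 1) (hlt : (p : ℝ)⁻¹ < ‖z‖ ^ lam G) :
    ‖∑' k, ((algebraMap ℚ_[p] ℂ_[p]).comp (algebraMap ℤ_[p] ℚ_[p])) (PowerSeries.coeff k F) * z ^ k‖ <
        ‖∑' k, ((algebraMap ℚ_[p] ℂ_[p]).comp (algebraMap ℤ_[p] ℚ_[p])) (PowerSeries.coeff k G) * z ^ k‖ ↔ mu G < mu F := by
  obtain ⟨hlamle, hltF, hvF, hvG⟩ := norm_eq_of_dvd_C_pow_mul_of_lt_norm_pow_lam hF hG hdvd hz hlt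
  rw [hvF, hvG]
  set q : ℝ := (p : ℝ)⁻¹ with hq
  set t : ℝ := ‖z‖ with ht
  obtain ⟨hq0, hq1⟩ := inv_prime_pos_and_lt_one (p := p)
  have htF1 : t ^ lam F ≤ 1 := pow_le_one₀ (norm_nonneg _) hz.le
  have htG1 : t ^ lam G ≤ 1 := pow_le_one₀ (norm_nonneg _) hz.le
  have htGF : t ^ lam G ≤ t ^ lam F := pow_le_pow_of_le_one (norm_nonneg _) hz.le hlamle
  constructor
  · intro h
    by_contra hle
    rw [not_lt] at hle
    rcases hle.lt_or_eq with hlt' | heq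
    · have h1 : q ^ mu G ≤ q ^ (mu F + 1) := pow_le_pow_of_le_one hq0.le hq1.le (by omega)
      have : q ^ mu G * t ^ lam G < q ^ mu F * t ^ lam F := by
        calc q ^ mu G * t ^ lam G ≤ q ^ (mu F + 1) * 1 := by gcongr
          _ = q ^ mu F * q := by rw [mul_one, pow_succ]
          _ < q ^ mu F * t ^ lam F := by gcongr
      exact absurd h (not_lt.mpr this.le)
    · rw [heq] at h
      exact absurd h (not_lt.mpr (by gcongr))
  · intro hμ
    have h1 : q ^ mu F ≤ q ^ (mu G + 1) := pow_le_pow_of_le_one hq0.le hq1.le (by omega)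
    calc q ^ mu F * t ^ lam F ≤ q ^ (mu G + 1) * 1 := by gcongr
      _ = q ^ mu G * q := by rw [mul_one, pow_succ]
      _ < q ^ mu G * t ^ lam G := by gcongr

/-- ★★★ **`|F(z)| = |G(z)| ⟺ (μ(F), λ(F)) = (μ(G), λ(G))` at a point high for `G`** (same hypotheses) — the iff-form of this gen's high-character rigidity —
and `μ(F) = μ(G) ⟹ |G(z)| ≤ |F(z)|` (`λ(F) ≤ λ(G)`, `|z| ≤ 1`). With `norm_lt_norm_iff_mu_lt`: on a pair with `μ(G) ≤ μ(F)` known (weight-, twin- or layer-certified,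
gens 52–53) the value of `F` is strictly below that of `G` iff `μ(G) < μ(F)`, equal iff the invariants (and then the ideals) agree, and above iff `μ` agree but
`λ(F) < λ(G)`. [cite: Washington1997, §7.1–7.2 and Thm. 7.3] [cite: GreenbergVatsal2000, p. 4 (after Thm. (1.2))] [cite: GreenbergLNM1716, p. 180] -/
theorem norm_eq_norm_iff_mu_eq_and_lam_eq {F G : IwasawaAlgebra p} (hF : F ≠ 0) (hG : G ≠ 0) {a : ℕ}
    (hdvd : F ∣ PowerSeries.C ((p : ℤ_[p]) ^ a) * G) {z : ℂ_[p]} (hz : ‖z‖ < 1) (hlt : (p : ℝ)⁻¹ < ‖z‖ ^ lam G) :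
    (‖∑' k, ((algebraMap ℚ_[p] ℂ_[p]).comp (algebraMap ℤ_[p] ℚ_[p])) (PowerSeries.coeff k F) * z ^ k‖ =
        ‖∑' k, ((algebraMap ℚ_[p] ℂ_[p]).comp (algebraMap ℤ_[p] ℚ_[p])) (PowerSeries.coeff k G) * z ^ k‖ ↔ mu F = mu G ∧ lam F = lam G) ∧
    (mu F = mu G →
      ‖∑' k, ((algebraMap ℚ_[p] ℂ_[p]).comp (algebraMap ℤ_[p] ℚ_[p])) (PowerSeries.coeff k G) * z ^ k‖ ≤
        ‖∑' k, ((algebraMap ℚ_[p] ℂ_[p]).comp (algebraMap ℤ_[p] ℚ_[p])) (PowerSeries.coeff k F) * z ^ k‖) := by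
  obtain ⟨hlamle, -, hvF, hvG⟩ := norm_eq_of_dvd_C_pow_mul_of_lt_norm_pow_lam hF hG hdvd hz hlt
  refine ⟨⟨fun h ↦ ?_, fun h ↦ by rw [hvF, hvG, h.1, h.2]⟩, fun hμ ↦ ?_⟩
  · obtain ⟨hμ, hl, -, -⟩ := mu_eq_and_lam_eq_of_highCertified hF hG hdvd hz hlt h
    exact ⟨hμ, hl⟩
  · rw [hvF, hvG, hμ]
    exact mul_le_mul_of_nonneg_left (pow_le_pow_of_le_one (norm_nonneg _) hz.le hlamle)
      (pow_nonneg (inv_nonneg.mpr (Nat.cast_nonneg _)) _)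

end Compare

/-! ## §2 The datum at any prime `p` -/

variable (W : WeierstrassCurve ℚ) [W.IsGloballyMinimal] (p : ℕ) [hp : Fact p.Prime]

/-- **Kato at `p`, pulled back to `Λ`: `f_X ∣ p^n·G`.** `W/ℚ` globally minimal, ordinary at `p`, `f` a newform of `W` with an INTEGRAL lift `G` of `L_p(f, α)`
(`ι G = L_p(f, α)`); PRINT `h17` = Kato's Thm. 17.4 (1)(2) at `p` for `f`. Then for every cyclotomic dual datum `D` with `char X = (f_X)`: `X` is `Λ`-torsion and
**`f_X ∣ p^n · G` for some `n`** (the tree's `O1.MuZeroUpgrade.exists_mul_charGen_eq_of_kato_allPrimes` at `ϖ = 1`). [cite: Kato2004Asterisque, Thm. 17.4 (1)(2) (p. 273)] -/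
theorem charGen_dvd_C_pow_mul_lift {N : ℕ} [NeZero N] {f : CuspForm (Gamma0 N) 2} (h17 : kato_divisibility_allPrimes W p (f := f))
    {κ : ZpExtension ℚ p} {γ : Field.absoluteGaloisGroup ℚ} (hκ : κ.IsCyclotomic) (hγ : κ.IsTopGenerator γ) (hγ' : IsCyclotomicVariable p γ)
    (hord : IsOrdinaryAt W p) (hf : IsNewformOf W f) (D : W.SelmerDualData κ γ) {fX : IwasawaAlgebra p}
    (hchar : D.charIdeal = Ideal.span {fX}) {G : IwasawaAlgebra p}
    (hG : iwasawaToPowerSeries p G = padicLFunction f (unitRoot W p : ℚ_[p])) :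
    D.IsTorsion ∧ ∃ n : ℕ, fX ∣ PowerSeries.C ((p : ℤ_[p]) ^ n) * G := by
  have hG' : iwasawaToPowerSeries p G = PowerSeries.C ((1 : ℚ) : ℚ_[p]) * padicLFunction f (unitRoot W p : ℚ_[p]) := by
    rw [Rat.cast_one, map_one, one_mul]; exact hG
  obtain ⟨hD, a, n, hkey⟩ := O1.MuZeroUpgrade.exists_mul_charGen_eq_of_kato_allPrimes W p h17 hκ hγ hγ' hord hf D hchar hG'
  refine ⟨hD, n, a, ?_⟩
  rw [Rat.num_one, Rat.den_one, Int.cast_one, Nat.cast_one, map_one, one_mul, one_mul] at hkey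
  rw [← hkey, mul_comm]

/-- ★★★ **THE MAIN CONJECTURE AT THE DATUM FROM ONE HIGH TWISTED VALUE (any `p`).** `W/ℚ` globally minimal, ordinary at `p`; `f` a newform of `W`, `G ≠ 0` an
integral lift of `L_p(f, α)`; PRINT `h17` (Kato 17.4 (1)(2) at `p`). At a cyclotomic dual datum `D` with `char_Λ X = (f_X)`, `f_X ≠ 0`, suppose ONE character `ζ ∈ ℂ_p`
of EXACT order `p^{n+1}` is HIGH for `G` — **`λ(G) < (p−1)·p^n`** — and CERTIFIED: **`|f_X(ζ − 1)| = |G(ζ − 1)|`**. Then **`μ(f_X) = μ(G)`, `λ(f_X) = λ(G)`,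
`char_Λ X = (G)`** — no `μ = 0` input. At odd `p` with `λ_an < p − 1` a character of order `p` (first layer) suffices. [cite: Kato2004Asterisque, Thm. 17.4 (1)(2) (p. 273)]
[cite: Washington1997, §7.1–7.2 and Thm. 7.3] [cite: GreenbergLNM1716, p. 180] [cite: GreenbergVatsal2000, p. 4 (after Thm. (1.2))] -/
theorem charIdeal_eq_of_kato_of_highCharacterCertified {N : ℕ} [NeZero N] {f : CuspForm (Gamma0 N) 2}
    (h17 : kato_divisibility_allPrimes W p (f := f)) {κ : ZpExtension ℚ p} {γ : Field.absoluteGaloisGroup ℚ}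
    (hκ : κ.IsCyclotomic) (hγ : κ.IsTopGenerator γ) (hγ' : IsCyclotomicVariable p γ) (hord : IsOrdinaryAt W p) (hf : IsNewformOf W f)
    (D : W.SelmerDualData κ γ) {fX : IwasawaAlgebra p} (hfX : fX ≠ 0) (hchar : D.charIdeal = Ideal.span {fX}) {G : IwasawaAlgebra p} (hG0 : G ≠ 0)
    (hG : iwasawaToPowerSeries p G = padicLFunction f (unitRoot W p : ℚ_[p])) {n : ℕ} {ζ : ℂ_[p]} (hζ : ζ ^ p ^ (n + 1) = 1) (hζ' : ζ ^ p ^ n ≠ 1)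
    (hhigh : lam G < (p - 1) * p ^ n)
    (hcert : ‖∑' k, ((algebraMap ℚ_[p] ℂ_[p]).comp (algebraMap ℤ_[p] ℚ_[p])) (PowerSeries.coeff k fX) * (ζ - 1) ^ k‖ =
      ‖∑' k, ((algebraMap ℚ_[p] ℂ_[p]).comp (algebraMap ℤ_[p] ℚ_[p])) (PowerSeries.coeff k G) * (ζ - 1) ^ k‖) :
    mu fX = mu G ∧ lam fX = lam G ∧ D.charIdeal = Ideal.span {G} := by
  obtain ⟨-, m, hdvd⟩ := charGen_dvd_C_pow_mul_lift W p h17 hκ hγ hγ' hord hf D hchar hG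
  obtain ⟨-, hzlt, -, hiff⟩ := inv_lt_norm_sub_one_pow_iff (p := p) hζ hζ' (lam G)
  obtain ⟨hμ, hl, -, hspan⟩ := mu_eq_and_lam_eq_of_highCertified hfX hG0 hdvd hzlt (hiff.mpr hhigh) hcert
  exact ⟨hμ, hl, hchar.trans hspan⟩

/-- ★★★ **THE MAIN CONJECTURE AT THE DATUM FROM ONE LAYER-GROWTH EQUALITY (any `p`).** Same setting; if for ONE `n` with **`λ(G) < (p−1)·p^n`** the growth numbers
agree, **`(p−1)p^n·μ(f_X) + λ(f_X) = (p−1)p^n·μ(G) + λ(G)`** (displayed input: the algebraic growth `e_{n+1} − e_n` of `X` against the analytic one at ONE layer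
that is high for `λ_an`), then **`μ(f_X) = μ(G)`, `λ(f_X) = λ(G)`, `char_Λ X = (G)`**. [cite: Kato2004Asterisque, Thm. 17.4 (1)(2) (p. 273)]
[cite: Washington1997, §13.3 Thm. 13.13] [cite: GreenbergVatsal2000, p. 4 (after Thm. (1.2))] -/
theorem charIdeal_eq_of_kato_of_growth_eq {N : ℕ} [NeZero N] {f : CuspForm (Gamma0 N) 2}
    (h17 : kato_divisibility_allPrimes W p (f := f)) {κ : ZpExtension ℚ p} {γ : Field.absoluteGaloisGroup ℚ}
    (hκ : κ.IsCyclotomic) (hγ : κ.IsTopGenerator γ) (hγ' : IsCyclotomicVariable p γ) (hord : IsOrdinaryAt W p) (hf : IsNewformOf W f)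
    (D : W.SelmerDualData κ γ) {fX : IwasawaAlgebra p} (hfX : fX ≠ 0) (hchar : D.charIdeal = Ideal.span {fX}) {G : IwasawaAlgebra p} (hG0 : G ≠ 0)
    (hG : iwasawaToPowerSeries p G = padicLFunction f (unitRoot W p : ℚ_[p])) {n : ℕ} (hhigh : lam G < (p - 1) * p ^ n)
    (hgrowth : (p - 1) * p ^ n * mu fX + lam fX = (p - 1) * p ^ n * mu G + lam G) :
    mu fX = mu G ∧ lam fX = lam G ∧ D.charIdeal = Ideal.span {G} := by
  obtain ⟨-, m, hdvd⟩ := charGen_dvd_C_pow_mul_lift W p h17 hκ hγ hγ' hord hf D hchar hG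
  have hP := weierstrassDistinguished_pfree_dvd_of_dvd_C_pow_mul hfX hG0 hdvd
  have hlamle : lam fX ≤ lam G := by
    rw [lam_eq_natDegree_weierstrassDistinguished (eq_C_pow_mu_mul_pfree fX) (red_pfree_ne_zero hfX),
      lam_eq_natDegree_weierstrassDistinguished (eq_C_pow_mu_mul_pfree G) (red_pfree_ne_zero hG0)]
    exact Polynomial.natDegree_le_of_dvd hP ((pfree G).isDistinguishedAt_weierstrassDistinguished (red_pfree_ne_zero hG0)).monic.ne_zero
  obtain ⟨hμ, hl⟩ := mu_eq_and_lam_eq_of_growth_eq hlamle hhigh hgrowth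
  exact ⟨hμ, hl, hchar.trans (span_eq_of_mu_eq_of_weierstrassDistinguished_eq hfX hG0 hμ (weierstrassDistinguished_eq_of_dvd_of_lam_eq hfX hG0 hdvd hl).1)⟩

end Summit.BirchSwinnertonDyer.BirchSwinnertonDyer.Theorems.AlignedTransportAtTwoHalfDescentHighGrowthAnyPrime

end
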